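import Summits.BirchSwinnertonDyer.BirchSwinnertonDyer.Theorems.PrintCf2SplitBadTwoCMShaBottomValueOfSel
import Summits.BirchSwinnertonDyer.BirchSwinnertonDyer.Theorems.PrintCf2SplitBadTwoKummerStrictAtV
import Summits.BirchSwinnertonDyer.BirchSwinnertonDyer.Theorems.PrintCf2SplitBadTwoH2Holds
import HarnessLib

/-!
# Crux `PrintCf2.SplitBadTwoRankOneOfFacts` (stmt-BirchSwinnertonDyer-20368), road α v10.3, S3c residual (F3), leaf (ShaFin):
# **`Ш(W/ℚ)[2^∞]` and `Ш(W_K/K)[2^∞]` ARE FINITE ON EVERY S3c FRAME** (from `Finite 𝔖_{v̄}(K, W*)` alone)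

Cell `bsd-print-cf2`, EXTRA WIDTH seat `bsd-line-cf2-p1-w6` g4 (prover-bsd-line-cf2-p1-w6-g4-0); `--supports stmt-BirchSwinnertonDyer-20368`
(helper, Theses-free). HONEST FRAMING: nothing here closes the crux or a registered stub; BSD is not proved by any of this; no summit statement
is proved by this seat. No definition, no named fact, no `sorry`, no kit. beyond-print theorem: no.

WHAT. The plain-road reduction of the last displayed hypothesis `hcounts` of S3c (-w5 g3 `hF3_of_levelCounts`, p678471; LEAD g13 cut 16)
reads, per frame, `hcounts ⟸ (PI) ∧ (PIN) ∧ (ShaFin)` (-w8 g3, STATUS 2026-08-28T23:47:10Z), where **(ShaFin) = `Finite Ш(W_K/K)[2^∞]`** is the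
instance `[Finite (AddCommGroup.primaryComponent (W.baseChange K).sha 2)]` consumed by -w8 g3's
`SelmerLocImage.exists_relIndex_selmerGroup_kummerOutside_eq_index_two` (p677570) and its successors. This file proves it on every S3c frame
(binders of `hF3` / `hcounts` VERBATIM, through `Finite (restrictedSelmerBase W* 2 v̄)`):

* `finite_sha_two_primary_of_frame` — **`Ш(W/ℚ)[2^∞]` is finite**: the middle factor `(𝔖_v(K, W*) ⊓ L_M) ⧸ Q_M` of -w7 g2's three-factor
  decomposition of `#𝔖_{v̄}(K, W*)` is finite when `𝔖_{v̄}(K, W*)` is (`finite_three_of_finite_restrictedSelmerBase_of_local`, with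
  `hL := ker_resOfLe_le_comap_localKerOver`, `hQ := comap_kummer_le_restrictedSelmerBase_of_strict ∘ CMPrimes.hH1_holds` (-w3 g9, (H1′)),
  `hcov := CMPrimes.hH2_holds` (-w2 g11, (H2))), and its cardinality IS `#Ш(W/ℚ)[2^∞]` (-w8 g2
  `natCard_trueSelmer_quotient_eq_sha_of_frame_of_sel` ∘ -w3 g9 `CMPrimes.hSel_holds`); a `Nat.card` that is the cardinality of a finite
  type is `≠ 0`, so `Ш(W/ℚ)[2^∞]` is finite (`Nat.finite_of_card_ne_zero`).
* `finite_sha_two_primary_baseChange_of_frame` — **`Ш(W_K/K)[2^∞]` is finite**: `#Ш(W_K)[2^∞] = (#Ш(W/ℚ)[2^∞])²` (-w8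
  `CMPrimes.natCard_sha_two_primary_baseChange_eq_sq`, Gross's CM descent; `√−7 ∈ K` by `exists_sq_eq_neg_seven_of_frame_cmEndo`) is then `≠ 0`.
* `natCard_sha_two_primary_pos_of_frame` — the `0 < #Ш(W/ℚ)[2^∞] ∧ 0 < #Ш(W_K/K)[2^∞]` reading (no junk zero in the (R-BV)/(F2) laws).

So after this file the plain road's frame instance (ShaFin) is a theorem; (PI) (-w2 g11 / -w8 g3) and (PIN) (-w3 g10) remain.

References: A. Agboola, Compositio 143 (2007) §6 Props. 6.5, 6.10, 6.11 [Agboola2007]; B. H. Gross, in: LMS Lecture Notes 153 (1991) §5 (5.1)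
[GrossLMS1991]; R. Greenberg, LNM 1716 (1999) §2 [GreenbergLNM1716].
-/

noncomputable section

open scoped Classical

set_option linter.dupNamespace false
set_option autoImplicit false

open NumberField IsDedekindDomain Field WeierstrassCurve
open Literature.NumberTheory.EllipticCurves Literature.NumberTheory.EllipticCurves.GreenbergSelmer
open Literature.NumberTheory.EllipticCurves.Castella2018.AcSelmer
open Literature.NumberTheory.EllipticCurves.Agboola2007
open Literature.NumberTheory.EllipticCurves.ResKernel
open Literature.NumberTheory.GaloisRepresentations

namespace Summit.BirchSwinnertonDyer.BirchSwinnertonDyer.Theorems.PrintCf2.CMPrimes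

open Summit.BirchSwinnertonDyer.BirchSwinnertonDyer.Theorems.PrintCf2.RestrictedSelmerPair
open Summit.BirchSwinnertonDyer.BirchSwinnertonDyer.Theorems.PrintCf2.AdditiveAtSeven

/-- **(ShaFin) over `ℚ`: `Ш(W/ℚ)[2^∞]` is finite on every S3c frame** (binders of `hF3`/`hcounts` VERBATIM). The middle factor of the
three-factor decomposition of the finite group `𝔖_{v̄}(K, W*)` is finite and has cardinality `#Ш(W/ℚ)[2^∞]`.
[cite: Agboola2007, Props. 6.5, 6.10, 6.11 (arXiv p0014:L1–p0015:L12)] [cite: GrossLMS1991, §5 (5.1)] -/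
theorem finite_sha_two_primary_of_frame :
    ∀ (d : ℤ), d ≠ 0 → Squarefree d → d % 4 ≠ 1 →
      ∀ (W : WeierstrassCurve ℚ) [W.IsElliptic] [W.IsGloballyMinimal] (C : VariableChange ℚ),
        C • W = cm7.quadraticTwist (d : ℚ) → W.analyticRank = 1 →
      ∀ (K : Type) [Field K] [NumberField K], IsImaginaryQuadratic K →
      ∀ (v vbar : HeightOneSpectrum (𝓞 K)),
        ((2 : ℕ) : 𝓞 K) ∈ v.asIdeal → ((2 : ℕ) : 𝓞 K) ∈ vbar.asIdeal → vbar ≠ v →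
      ∀ (π : (W.baseChange K).endRing), (π : AddMonoid.End (W.baseChange K).geomPoints) * π = π - 2 →
      ∀ (r : ℤ_[2]), r * r = r - 2 →
        (∀ τ ∈ GreenbergSelmer.inertia v, ∀ x : ↥((W.baseChange K).endEigenPrimaryTorsion 2 π r), τ • x = x ∨ τ • x = -x) →
      ∀ (P : W.toAffine.Point) (c₀ : ℕ) (ℓ : ℤ),
        ¬ IsOfFinAddOrder P →
        (∀ R : W.toAffine.Point, ∃ (k : ℤ) (T : W.toAffine.Point), IsOfFinAddOrder T ∧ R = k • P + T) →
        c₀ ≠ 0 → (W.baseChange ℚ_[2]).IsInReductionKernel (c₀ • W.toPadicPoint 2 P) →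
        ‖(W.baseChange ℚ_[2]).padicLogPoint (c₀ • W.toPadicPoint 2 P) / (c₀ : ℚ_[2])‖ = (2 : ℝ) ^ (-ℓ) →
      Finite (restrictedSelmerBase ↥((W.baseChange K).endEigenPrimaryTorsion 2 π r) 2 vbar) →
        Finite (AddCommGroup.primaryComponent W.sha 2) := by
  intro d hd0 hsq hd4 W _ _ C hC hrank K _ _ hK v vbar hv hvbar hne π hπ r hr hpin P c₀ ℓ hP hgen hc₀ hker hlog hfin
  haveI : Fact (Nat.Prime 2) := ⟨Nat.prime_two⟩
  haveI := hfin
  have hcompl := endEigenPrimaryTorsion_compl_of_frame hd0 W C hC K π hπ hr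
  -- (H1′): the summand's Kummer classes are strict at `v`; (H2): exhaustion at `v̄`; (H1-Sel): the Selmer-level CM input
  have hH1' := hH1_holds d hd0 hsq hd4 W C hC hrank K hK v vbar hv hvbar hne π hπ r hr hpin P c₀ ℓ hP hgen hc₀ hker hlog hfin
  have hH2' := hH2_holds d hd0 hsq hd4 W C hC hrank K hK v vbar hv hvbar hne π hπ r hr hpin P c₀ ℓ hP hgen hc₀ hker hlog hfin
  have hSel' := hSel_holds d hd0 hsq hd4 W C hC hrank K hK v vbar hv hvbar hne π hπ r hr hpin P c₀ ℓ hP hgen hc₀ hker hlog hfin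
  -- `Q_M ≤ 𝔖_v(K, W*)`
  have hQ := comap_kummer_le_restrictedSelmerBase_of_strict (W.baseChange K) 2 π r (1 - r) v hK hcompl.1 hcompl.2 hH1'
  -- the middle factor `(𝔖_v ⊓ L_M) ⧸ Q_M` of the finite group `𝔖_{v̄}(K, W*)` is finite
  obtain ⟨-, hmid, -⟩ := finite_three_of_finite_restrictedSelmerBase_of_local
    ↥((W.baseChange K).endEigenPrimaryTorsion 2 π r) 2 v vbar
    (((W.baseChange K).localKerOver 2 ⊤ (vbar.adicCompletion K)).comap
      (resH1Hom (ContinuousMonoidHom.id _) ((W.baseChange K).endEigenPrimaryTorsion 2 π r).subtype (fun _ _ ↦ rfl)))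
    (((((W.baseChange K).kummerMapPInfty 2 (W.baseChange K).zsmul_geomPoints_surjective_holds).range).map
        (resSubgroup ⊤ ((W.baseChange K).geomPrimaryTorsion 2))).comap
      (resH1Hom (ContinuousMonoidHom.id _) ((W.baseChange K).endEigenPrimaryTorsion 2 π r).subtype (fun _ _ ↦ rfl)))
    (ker_resOfLe_le_comap_localKerOver (W.baseChange K) 2 π r vbar)
    (le_inf hQ (comap_kummer_le_comap_localKerOver (W.baseChange K) 2 π r vbar)) hH2'
  -- … and its cardinality is `#Ш(W/ℚ)[2^∞]`
  have hcard := natCard_trueSelmer_quotient_eq_sha_of_frame_of_sel hd0 W C hC hK v vbar hv hvbar hne π hπ hr hSel'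
  haveI := hmid
  have hne0 : Nat.card (AddCommGroup.primaryComponent W.sha 2) ≠ 0 := by
    rw [← hcard]
    exact Nat.card_pos.ne'
  exact Nat.finite_of_card_ne_zero hne0

/-- **(ShaFin) over `K`: `Ш(W_K/K)[2^∞]` is finite on every S3c frame** (binders of `hF3`/`hcounts` VERBATIM) — the instance
`[Finite (AddCommGroup.primaryComponent (W.baseChange K).sha 2)]` of the plain road (-w8 g3 p677570 / p678401 / p679115):
`#Ш(W_K)[2^∞] = (#Ш(W/ℚ)[2^∞])² ≠ 0`. [cite: GrossLMS1991, §5 (5.1)] [cite: Agboola2007, Props. 6.10, 6.11] -/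
theorem finite_sha_two_primary_baseChange_of_frame :
    ∀ (d : ℤ), d ≠ 0 → Squarefree d → d % 4 ≠ 1 →
      ∀ (W : WeierstrassCurve ℚ) [W.IsElliptic] [W.IsGloballyMinimal] (C : VariableChange ℚ),
        C • W = cm7.quadraticTwist (d : ℚ) → W.analyticRank = 1 →
      ∀ (K : Type) [Field K] [NumberField K], IsImaginaryQuadratic K →
      ∀ (v vbar : HeightOneSpectrum (𝓞 K)),
        ((2 : ℕ) : 𝓞 K) ∈ v.asIdeal → ((2 : ℕ) : 𝓞 K) ∈ vbar.asIdeal → vbar ≠ v →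
      ∀ (π : (W.baseChange K).endRing), (π : AddMonoid.End (W.baseChange K).geomPoints) * π = π - 2 →
      ∀ (r : ℤ_[2]), r * r = r - 2 →
        (∀ τ ∈ GreenbergSelmer.inertia v, ∀ x : ↥((W.baseChange K).endEigenPrimaryTorsion 2 π r), τ • x = x ∨ τ • x = -x) →
      ∀ (P : W.toAffine.Point) (c₀ : ℕ) (ℓ : ℤ),
        ¬ IsOfFinAddOrder P →
        (∀ R : W.toAffine.Point, ∃ (k : ℤ) (T : W.toAffine.Point), IsOfFinAddOrder T ∧ R = k • P + T) →
        c₀ ≠ 0 → (W.baseChange ℚ_[2]).IsInReductionKernel (c₀ • W.toPadicPoint 2 P) →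
        ‖(W.baseChange ℚ_[2]).padicLogPoint (c₀ • W.toPadicPoint 2 P) / (c₀ : ℚ_[2])‖ = (2 : ℝ) ^ (-ℓ) →
      Finite (restrictedSelmerBase ↥((W.baseChange K).endEigenPrimaryTorsion 2 π r) 2 vbar) →
        Finite (AddCommGroup.primaryComponent (W.baseChange K).sha 2) := by
  intro d hd0 hsq hd4 W _ _ C hC hrank K _ _ hK v vbar hv hvbar hne π hπ r hr hpin P c₀ ℓ hP hgen hc₀ hker hlog hfin
  haveI : Fact (Nat.Prime 2) := ⟨Nat.prime_two⟩
  haveI := finite_sha_two_primary_of_frame d hd0 hsq hd4 W C hC hrank K hK v vbar hv hvbar hne π hπ r hr hpin P c₀ ℓ hP hgen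
    hc₀ hker hlog hfin
  obtain ⟨θ, hθ⟩ := exists_sq_eq_neg_seven_of_frame_cmEndo hd0 W C hC π hπ
  have hne0 : Nat.card (AddCommGroup.primaryComponent (W.baseChange K).sha 2) ≠ 0 := by
    rw [natCard_sha_two_primary_baseChange_eq_sq W (j_eq_of_smul_eq_cm7Twist hd0 W C hC) hK hθ]
    exact pow_ne_zero _ Nat.card_pos.ne'
  exact Nat.finite_of_card_ne_zero hne0

/-- **No junk zero on the frame**: `0 < #Ш(W/ℚ)[2^∞]` and `0 < #Ш(W_K/K)[2^∞]` (both `Nat.card`s are cardinalities of finite groups), so the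
Ш-terms of the (F2)/(R-BV) laws of S3c are honest cardinalities. [cite: GrossLMS1991, §5 (5.1)] [cite: Agboola2007, Props. 6.10, 6.11] -/
theorem natCard_sha_two_primary_pos_of_frame :
    ∀ (d : ℤ), d ≠ 0 → Squarefree d → d % 4 ≠ 1 →
      ∀ (W : WeierstrassCurve ℚ) [W.IsElliptic] [W.IsGloballyMinimal] (C : VariableChange ℚ),
        C • W = cm7.quadraticTwist (d : ℚ) → W.analyticRank = 1 →
      ∀ (K : Type) [Field K] [NumberField K], IsImaginaryQuadratic K →
      ∀ (v vbar : HeightOneSpectrum (𝓞 K)),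
        ((2 : ℕ) : 𝓞 K) ∈ v.asIdeal → ((2 : ℕ) : 𝓞 K) ∈ vbar.asIdeal → vbar ≠ v →
      ∀ (π : (W.baseChange K).endRing), (π : AddMonoid.End (W.baseChange K).geomPoints) * π = π - 2 →
      ∀ (r : ℤ_[2]), r * r = r - 2 →
        (∀ τ ∈ GreenbergSelmer.inertia v, ∀ x : ↥((W.baseChange K).endEigenPrimaryTorsion 2 π r), τ • x = x ∨ τ • x = -x) →
      ∀ (P : W.toAffine.Point) (c₀ : ℕ) (ℓ : ℤ),
        ¬ IsOfFinAddOrder P →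
        (∀ R : W.toAffine.Point, ∃ (k : ℤ) (T : W.toAffine.Point), IsOfFinAddOrder T ∧ R = k • P + T) →
        c₀ ≠ 0 → (W.baseChange ℚ_[2]).IsInReductionKernel (c₀ • W.toPadicPoint 2 P) →
        ‖(W.baseChange ℚ_[2]).padicLogPoint (c₀ • W.toPadicPoint 2 P) / (c₀ : ℚ_[2])‖ = (2 : ℝ) ^ (-ℓ) →
      Finite (restrictedSelmerBase ↥((W.baseChange K).endEigenPrimaryTorsion 2 π r) 2 vbar) →
        0 < Nat.card (AddCommGroup.primaryComponent W.sha 2) ∧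
          0 < Nat.card (AddCommGroup.primaryComponent (W.baseChange K).sha 2) := by
  intro d hd0 hsq hd4 W _ _ C hC hrank K _ _ hK v vbar hv hvbar hne π hπ r hr hpin P c₀ ℓ hP hgen hc₀ hker hlog hfin
  haveI := finite_sha_two_primary_of_frame d hd0 hsq hd4 W C hC hrank K hK v vbar hv hvbar hne π hπ r hr hpin P c₀ ℓ hP hgen
    hc₀ hker hlog hfin
  haveI := finite_sha_two_primary_baseChange_of_frame d hd0 hsq hd4 W C hC hrank K hK v vbar hv hvbar hne π hπ r hr hpin P c₀ ℓ
    hP hgen hc₀ hker hlog hfin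
  exact ⟨Nat.card_pos, Nat.card_pos⟩

end Summit.BirchSwinnertonDyer.BirchSwinnertonDyer.Theorems.PrintCf2.CMPrimes

end
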